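import Literature.NumberTheory.LFunctions.HeckeThetaComplexWeightMellin
import Literature.NumberTheory.EllipticCurves.HeckeGrossencharakterFunctionalEquationConductor
import Literature.NumberTheory.GaloisRepresentations.GrossencharakterPrimitive
import Literature.NumberTheory.GaloisRepresentations.HeckeLFunctionValueOfNegativeWeight
import Literature.NumberTheory.GaloisRepresentations.HeckeCharacterWeakApproximation
import Literature.NumberTheory.LFunctions.GrossencharakterFinitePartGaussSum
import HarnessLib

/-!
# STUB-IDEAS `stub_modThree` · k = 1 · generation 12 — typed helper targets (companion of `STUB-IDEAS-stub_modThree-1.md`)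

Crux `FreyModularity` (stmt-ABC-11340), line `Sketch`, stub `stub_modThree` (Langlands–Tunnell at `ρ̄_{E,3}`).
k1 = D-road: `stub ⇐ StubModThreeSurj ∧ TwoGroupBranch` (split kernel-checked in the g2/g6 companions); the 2-group
half reduces (g10 E0–E5 + landed `ModularForms.shimura1972_heckeTheta_isNewform0_of_primitive_of_heckeFE`, p837789) to the
named fact `Literature.NumberTheory.EllipticCurves.Hecke_functionalEquation_infinityType_conductor` (0 `_holds`).

GENERATION-12 DELTA (2026-09-01 00:05–00:22Z): the analytic half of that fact LANDED sorry-free for imaginary quadratic `K`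
(`HeckeThetaInversionComplexWeight.lean`, `HeckeThetaComplexWeightMellin.lean`: `heckeThetaC_const_inv`, `heckeThetaPairC`,
`isStrongFEPair_heckeThetaPairC`, `heckeThetaPairC_Λ_sub`, `heckeThetaPairC_Λ_eq`, `heckeThetaPairC_symm_Λ_eq`).
What remains is ARITHMETIC PACKAGING, typed below as one-cycle prover targets with their tree templates:

* `GrossFEClassPrimitive` (M4′) — Neukirch VII (8.6) for a PRIMITIVE Größencharakter datum of type `(m,0)`, class language
  (template: `LFunctions.rayClassLSeries_functional_equation'`, the finite-order sibling; inputs: the theta pairs above +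
  the finite part / Gauss sum of g11-H3b).  This is the porting seat's remaining file — DO NOT duplicate while it is live.
* `isGrossencharakter_conductor_primitive` (M5c), `heckeLFunction_eq_rayClassLSeries_conductor` (M5a),
  `heckeLFunctionConj_eq_rayClassLSeries_star_conductor` (M5b) — idelic ↔ ideal-theoretic dictionary at the CONDUCTOR
  (templates: `HeckeCharacter.exists_primitive_rayClass_of_isFiniteOrder`, `heckeLFunction_eq_rayClassLSeries_of_norm_eq_rpow`,
  `heckeLFunctionConj_eq_conj`, `IsGrossencharakter.primitive_of_conductor_eq`, `HeckeCharacter.ext_of_eventually_valueAtUniformizer_eq`).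
* `heckeFE_conductor_of_classFE` — the ASSEMBLY `M4′ → named fact`, kernel-checked modulo M5a–c (sorries only in M5a–c).
* §2b (added 00:35Z after `LFunctions/GrossencharakterFinitePartGaussSum.lean` landed at 00:28Z with the porting seat's OWN currency
  `HasEmbPowType 𝔪 σ m ψ` / `IsPrimitiveGross 𝔪 ψ σ m`): the two CURRENCY BRIDGES `hasEmbPowType_of_isGrossencharakter` (M5d) and
  `isPrimitiveGross_of_primitive` (M5e) from the consumer-side currency (`IsGrossencharakter` + clause (P), used by M4′, by
  `GrossencharakterPrimitive.lean` and by the Shimura consumer) to the seat's — so that M4′ ⇐ (the seat's (8.6) theorem) ∘ M5d ∘ M5e.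

Downstream (g11 companion, kernel-checked): `stubModThree_of_surj_of_heckeFE : StubModThreeSurj →
Hecke_functionalEquation_infinityType_conductor → StubModThree` (via E0–E5 of g10).
-/

noncomputable section

open scoped ComplexConjugate NumberField
open NumberField IsDedekindDomain
open Literature.NumberTheory.GaloisRepresentations Literature.NumberTheory.EllipticCurves
open Literature.NumberTheory.LFunctions (rayClassLSeries)

namespace Summit.ABC.ABC.Cruxes.FreyModularity.Sketch.StubModThreeIdeasK1G12

/-! ## §0. Landed in generation 12 (sanity references; sorry-free tree theorems) -/

example := @Literature.NumberTheory.LFunctions.NumberField.heckeThetaC_const_inv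
example := @Literature.NumberTheory.LFunctions.NumberField.heckeThetaPairC_Λ_sub
example := @Literature.NumberTheory.LFunctions.NumberField.heckeThetaPairC_Λ_eq
example := @Literature.NumberTheory.LFunctions.NumberField.heckeThetaPairC_symm_Λ_eq

/-! ## §1. M4′ — Hecke (8.6) for a primitive type-`(m,0)` datum, class language (the porting seat's remaining target) -/

/-- **M4′ (residual analytic+Gauss-sum assembly; template `rayClassLSeries_functional_equation'`).**  For `K` imaginary
quadratic, `𝔣 ≠ 0`, `m ≥ 1`, `ψ` a Größencharakter datum `mod 𝔣` of type `(m,0)` which is PRIMITIVE (`𝔣` = conductor, clause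
(P) of `GrossencharakterPrimitive.lean`): there are `W`, `|W| = 1`, and ENTIRE `Λ, Λ'` with
`Λ(s) = (|d_K|·N𝔣)^{s/2}(2π)^{-s}Γ(s)·Σ_𝔞 ψ̃(𝔞)N𝔞^{-s}`, `Λ'(s) =` the same with `ψ̄`, on `re s > m/2+1`, and `Λ(s) = W Λ'(m+1-s)`.
Proof route: `L = (1/w_𝔣) Σ_classes`, each class sum = `heckeThetaPairC_Λ_eq` of a theta pair; `heckeThetaPairC_Λ_sub` per class;
reassemble the dual side with the finite part `χ_f` and its Gauss sum (`sum_finitePart_mul_symm_Λ_eq`, `gaussSum_invariant`,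
`norm_gaussSum` templates; primitivity ⇒ `|τ(χ_f)| = √N𝔣` ⇒ `|W| = 1`). [NeukirchANT1999 VII (8.5)–(8.6); HeckeMathZ1920] -/
def GrossFEClassPrimitive : Prop :=
  ∀ (K : Type) [Field K] [NumberField K] (_hK : IsImaginaryQuadratic K) (𝔣 : Ideal (𝓞 K)) (_h𝔣 : 𝔣 ≠ ⊥)
    (m : ℕ) (_hm : 0 < m) (ψ : HeightOneSpectrum (𝓞 K) → ℂ)
    (_hψ : IsGrossencharakter 𝔣 (fun _ ↦ (m : ℤ)) (fun _ ↦ 0) ψ)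
    (_hprim : ∀ (𝔣₁ : Ideal (𝓞 K)) (ψ₁ : HeightOneSpectrum (𝓞 K) → ℂ), 𝔣 ≤ 𝔣₁ →
      (∀ v : HeightOneSpectrum (𝓞 K), ¬ 𝔣 ≤ v.asIdeal → ψ₁ v = ψ v) →
      IsGrossencharakter 𝔣₁ (fun _ ↦ (m : ℤ)) (fun _ ↦ 0) ψ₁ → 𝔣₁ = 𝔣),
    ∃ (W : ℂ) (Λ Λ' : ℂ → ℂ), ‖W‖ = 1 ∧ Differentiable ℂ Λ ∧ Differentiable ℂ Λ' ∧
      (∀ s : ℂ, (m : ℝ) / 2 + 1 < s.re →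
        Λ s = (((discr K).natAbs * Ideal.absNorm 𝔣 : ℕ) : ℂ) ^ (s / 2) *
            (2 * Real.pi : ℂ) ^ (-s) * Complex.Gamma s * rayClassLSeries 𝔣 ψ s ∧
        Λ' s = (((discr K).natAbs * Ideal.absNorm 𝔣 : ℕ) : ℂ) ^ (s / 2) *
            (2 * Real.pi : ℂ) ^ (-s) * Complex.Gamma s * rayClassLSeries 𝔣 (star ψ) s) ∧
      ∀ s : ℂ, Λ s = W * Λ' ((m : ℂ) + 1 - s)

/-! ## §2. M5 — the idelic ↔ ideal-theoretic dictionary at the conductor (one prover cycle each) -/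

variable {K : Type} [Field K] [NumberField K]

/-- **M5c.** The uniformiser values of an algebraic Hecke character of type `(m,0)` form a Größencharakter datum modulo the
CONDUCTOR `𝔣(χ)`, primitive there.  Route: any module of definition (`isModulus_conductorExponentAt` /
`exists_isModulus_of_ramified`) ⇒ `HasInfinityType.isGrossencharakter_valueAtUniformizer`; pass to `isGrossencharakter_conductor`;
identify `heckeOfGross _ _ = χ` by `HeckeCharacter.ext_of_eventually_valueAtUniformizer_eq` + `heckeOfGross_valueAtUniformizer`, so the
conductor product is `χ.conductor` (`conductor_def`); primitivity = `IsGrossencharakter.primitive_of_conductor_eq`.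
[NeukirchANT1999 VII (6.11), (6.14)] -/
theorem isGrossencharakter_conductor_primitive {χ : HeckeCharacter K} {m : ℕ}
    (hχ : χ.HasInfinityType (fun _ ↦ (m : ℤ)) (fun _ ↦ 0)) :
    IsGrossencharakter χ.conductor (fun _ ↦ (m : ℤ)) (fun _ ↦ 0) (fun v ↦ χ.valueAtUniformizer v) ∧
    ∀ (𝔣₁ : Ideal (𝓞 K)) (ψ₁ : HeightOneSpectrum (𝓞 K) → ℂ), χ.conductor ≤ 𝔣₁ →
      (∀ v : HeightOneSpectrum (𝓞 K), ¬ χ.conductor ≤ v.asIdeal → ψ₁ v = χ.valueAtUniformizer v) →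
      IsGrossencharakter 𝔣₁ (fun _ ↦ (m : ℤ)) (fun _ ↦ 0) ψ₁ → 𝔣₁ = χ.conductor := by
  sorry

/-- **M5a.** `L(χ,s) = Σ_{(𝔞,𝔣(χ))=1} χ̃(𝔞) N𝔞^{-s}` on `re s > m/2 + 1` for `χ` of type `(m,0)` over an imaginary quadratic field.
Route: exponent `σ = -m/2` (`norm_apply_eq_ideleNorm_rpow_of_hasInfinityType`, `wt = m`, `mult w = 2`), then
`heckeLFunction_eq_rayClassLSeries_of_norm_eq_rpow` with `𝔪 = χ.conductor` (`conductor_ne_bot`, `conductor_le_asIdeal_iff`).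
[NeukirchANT1999 VII (8.1); WeilBNT1967 VII §7] -/
theorem heckeLFunction_eq_rayClassLSeries_conductor (hK : IsImaginaryQuadratic K) {χ : HeckeCharacter K} {m : ℕ}
    (hχ : χ.HasInfinityType (fun _ ↦ (m : ℤ)) (fun _ ↦ 0)) {s : ℂ} (hs : (m : ℝ) / 2 + 1 < s.re) :
    heckeLFunction χ s = rayClassLSeries χ.conductor (fun v ↦ χ.valueAtUniformizer v) s := by
  sorry

/-- **M5b.** The dual side: `L(χ̄,s) = Σ conj(χ̃(𝔞)) N𝔞^{-s}` on `re s > m/2 + 1`.  Route: `heckeLFunctionConj_eq_conj`, M5a at `conj s`,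
and conjugation through the convergent `tsum` (`rayClassCoeff 𝔪 (star ψ) = conj ∘ rayClassCoeff 𝔪 ψ`, `conj (N^{-conj s}) = N^{-s}`).
[deShalit1987 II.1.1 (3)] -/
theorem heckeLFunctionConj_eq_rayClassLSeries_star_conductor (hK : IsImaginaryQuadratic K) {χ : HeckeCharacter K} {m : ℕ}
    (hχ : χ.HasInfinityType (fun _ ↦ (m : ℤ)) (fun _ ↦ 0)) {s : ℂ} (hs : (m : ℝ) / 2 + 1 < s.re) :
    heckeLFunctionConj χ s = rayClassLSeries χ.conductor (star fun v ↦ χ.valueAtUniformizer v) s := by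
  sorry

/-! ## §2b. Currency bridges to the porting seat's `HasEmbPowType` / `IsPrimitiveGross` (one prover cycle each) -/

/-- **M5d.** Over an imaginary quadratic field the archimedean monomial of type `(m,0)` collapses to `σ_w^m`, so an
`IsGrossencharakter 𝔣 (m,0) ψ` datum is a `HasEmbPowType 𝔣 σ_w m ψ` datum.  Route: `idealPow_span_mul_eq_of_isGrossencharakter`
(RayClassesColonIdeal.lean) with `ιK a = σ_w(a)^m` (`prod_embedding_zpow_one_zero`-style collapse, unique infinite place; the total
positivity side condition is void over a totally complex field). [NeukirchANT1999 VII (6.13)–(6.14)] -/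
theorem hasEmbPowType_of_isGrossencharakter (hK : IsImaginaryQuadratic K) (w : InfinitePlace K) {𝔣 : Ideal (𝓞 K)} {m : ℕ}
    {ψ : HeightOneSpectrum (𝓞 K) → ℂ} (hψ : IsGrossencharakter 𝔣 (fun _ ↦ (m : ℤ)) (fun _ ↦ 0) ψ) :
    Literature.NumberTheory.LFunctions.HasEmbPowType 𝔣 w.embedding m ψ := by
  sorry

/-- **M5e.** Primitivity transfer: clause (P) («no Größencharakter of the same type modulo a proper divisor agrees with `ψ` off `𝔣`»,
equivalently `𝔣` = conductor, `IsGrossencharakter.primitive_iff_conductor_eq`) implies Neukirch's «`χ_f` does not factor through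
`(𝓞/𝔣')^*` for `𝔣 ⊊ 𝔣'`».  Route: if `χ_f` factored through `(𝓞/𝔣')^*`, the same values `ψ` would be a Größencharakter `mod 𝔣'`
(ray relation mod `𝔣'` from `grossFinitePart_congr`-type bookkeeping), contradicting (P) with `ψ₁ = ψ`. [NeukirchANT1999 VII §6 p. 472, (6.11)] -/
theorem isPrimitiveGross_of_primitive (hK : IsImaginaryQuadratic K) (w : InfinitePlace K) {𝔣 : Ideal (𝓞 K)} (h𝔣 : 𝔣 ≠ ⊥)
    {m : ℕ} {ψ : HeightOneSpectrum (𝓞 K) → ℂ} (hψ : IsGrossencharakter 𝔣 (fun _ ↦ (m : ℤ)) (fun _ ↦ 0) ψ)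
    (hprim : ∀ (𝔣₁ : Ideal (𝓞 K)) (ψ₁ : HeightOneSpectrum (𝓞 K) → ℂ), 𝔣 ≤ 𝔣₁ →
      (∀ v : HeightOneSpectrum (𝓞 K), ¬ 𝔣 ≤ v.asIdeal → ψ₁ v = ψ v) →
      IsGrossencharakter 𝔣₁ (fun _ ↦ (m : ℤ)) (fun _ ↦ 0) ψ₁ → 𝔣₁ = 𝔣) :
    Literature.NumberTheory.LFunctions.IsPrimitiveGross 𝔣 ψ w.embedding m := by
  sorry

/-! ## §3. Assembly: M4′ + M5 ⇒ the named fact (kernel-checked modulo the M5 sorries) -/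

/-- **`GrossFEClassPrimitive → Hecke_functionalEquation_infinityType_conductor`** — the conductor-pinned named fact from the
class-language functional equation, through the M5 dictionary.  Template: `heckeLFunction_functional_equation_of_isFiniteOrder`. -/
theorem heckeFE_conductor_of_classFE (H : GrossFEClassPrimitive) : Hecke_functionalEquation_infinityType_conductor := by
  intro K _ _ hK χ m hm hχ
  obtain ⟨hψ, hprim⟩ := isGrossencharakter_conductor_primitive (K := K) hχ
  obtain ⟨W, Λ, Λ', hW, hΛ, hΛ', hval, hFE⟩ :=
    H K hK χ.conductor (HeckeCharacter.conductor_ne_bot χ) m hm _ hψ hprim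
  refine ⟨W, Λ, Λ', hW, hΛ, hΛ', fun s hs ↦ ?_, hFE⟩
  obtain ⟨h1, h2⟩ := hval s hs
  exact ⟨by rw [h1, heckeLFunction_eq_rayClassLSeries_conductor hK hχ hs],
    by rw [h2, heckeLFunctionConj_eq_rayClassLSeries_star_conductor hK hχ hs]⟩

end Summit.ABC.ABC.Cruxes.FreyModularity.Sketch.StubModThreeIdeasK1G12

end
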